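import Mathlib
import HarnessLib
import Literature.NumberTheory.Automorphic.StrongArtinCentralCharacter

/-!
# The centre of `GL₂(𝔸_ℚ)` acts on `π(τ)` by the Hecke character of `χ₁` when `det τ(Frob) = χ₁`

Stub `stub_centralCharacter` of line `Sketch` of crux
`Summit.Langlands.Langlands.Theses.QuarterDeficit1951.CorrespondentFingerprint`.

For an automorphic representation `π = W / W'` of `GL₂(𝔸_ℚ)` with `π = π(τ)` almost everywhere
(`IsPiOfArtinRep τ π`) and a Dirichlet character `χ₁` mod `N` with `det τ(Φ) = χ₁(q_v)` for the
arithmetic Frobenii `Φ` at every place `v ∤ N` at which `τ` is unramified, the centre `Z(𝔸_ℚ)` acts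
on `W / W'` by the Hecke character `ψ_{χ₁} = HeckeCharacter.ofDirichlet χ₁`.

Proof: the central character `ω` of `π(τ)` (`IsPiOfArtinRep.exists_centralCharacter_eq_det`,
Gelbart 1997, Thm. 2.1) has `ω(ϖ_v) = det τ(Φ)` at every `v` at which `τ` is unramified; at the
cofinitely many such `v` with moreover `v ∤ N` this is `χ₁(q_v) = ψ_{χ₁}(ϖ_v)`
(`HeckeCharacter.valueAtUniformizer_ofDirichlet`, Neukirch VII (6.9)), and two Hecke characters
agreeing at almost all uniformizers are equal
(`HeckeCharacter.ext_of_eventually_valueAtUniformizer_eq`, Cassels–Fröhlich VII Prop. 4.1).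
-/

set_option linter.dupNamespace false

noncomputable section

-- `Classical`: the place subtypes indexing `mixedSpace ℚ` are `Fintype` classically
-- (`NormedCommRing (mixedSpace ℚ)`, needed by `AutomorphyDatum.gl`).
open scoped NumberField Classical
open Literature.NumberTheory.Automorphic Literature.NumberTheory.GaloisRepresentations
  IsDedekindDomain NumberField
open Rat.HeightOneSpectrum

namespace Summit.Langlands.Langlands.Theorems.CorrespondentFingerprint

/-- The set of finite places of `ℚ` whose prime divides `N ≠ 0` is finite (it injects into the
prime factors of `N` under `v ↦ p_v`). [folklore] -/
theorem finite_setOf_natGenerator_dvd (N : ℕ) [NeZero N] :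
    {v : HeightOneSpectrum (𝓞 ℚ) | natGenerator v ∣ N}.Finite := by
  refine ((N.primeFactors : Set ℕ).toFinite.preimage Rat.natGenerator_injective.injOn).subset ?_
  intro v hv
  exact Nat.mem_primeFactors.2 ⟨prime_natGenerator v, hv, NeZero.ne N⟩

/-- Almost every finite place of `ℚ` is prime to `N ≠ 0`. [folklore] -/
theorem eventually_not_natGenerator_dvd (N : ℕ) [NeZero N] :
    ∀ᶠ v : HeightOneSpectrum (𝓞 ℚ) in Filter.cofinite, ¬ natGenerator v ∣ N :=
  (finite_setOf_natGenerator_dvd N).compl_mem_cofinite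

/-- **The centre acts on `π(τ)` by the Hecke character of `χ₁`.**  If `π = π(τ)` almost everywhere
and, at every place `v ∤ N` where `τ` is unramified, `det τ(Φ) = χ₁(q_v)` for the arithmetic
Frobenii `Φ` (`χ₁` a Dirichlet character mod `N`), then the centre `Z(𝔸_ℚ)` acts on `W / W'` by the
Hecke character `ψ_{χ₁}` of `χ₁` (`HeckeCharacter.ofDirichlet`): `r(z · 1₂) φ - ψ_{χ₁}(z) φ ∈ W'`.
The central character `ω` of `π(τ)` is the finite-order Hecke character with `ω(ϖ_v) = det τ(Φ)`
at the unramified places (`IsPiOfArtinRep.exists_centralCharacter_eq_det`), which is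
`χ₁(q_v) = ψ_{χ₁}(ϖ_v)` at almost all `v` (`HeckeCharacter.valueAtUniformizer_ofDirichlet`), and two
Hecke characters with the same values at almost all uniformizers coincide
(`HeckeCharacter.ext_of_eventually_valueAtUniformizer_eq`).
[cite: Gelbart1997, Thm. 2.1] [cite: NeukirchANT1999, Ch. VII Prop. (6.9)] -/
theorem stub_centralCharacter : ∀ (hcpt : isCompact_glFiniteIntegralLevel 2 ℚ)
    (π : AutomorphicRepData (AutomorphyDatum.gl 2 ℚ hcpt)) (τ : FramedArtinRep ℚ 2)
    (N : ℕ) [NeZero N] (χ₁ : DirichletCharacter ℂ N),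
    IsPiOfArtinRep τ π →
    (∀ v : HeightOneSpectrum (𝓞 ℚ), τ.IsUnramifiedAt v → ¬ natGenerator v ∣ N →
      ∀ 𝔓 ∈ v.primesAbove, ∀ Φ : Field.absoluteGaloisGroup ℚ, IsArithFrobAt (𝓞 ℚ) Φ 𝔓 →
        ((FramedRep.det τ Φ : ℂˣ) : ℂ) = χ₁ ((v.residueCard : ℕ) : ZMod N)) →
    ∀ (z : ideleGroup ℚ), ∀ φ ∈ π.W,
      rightTranslation (AdelicGroupData.gl 2 ℚ) (Matrix.GeneralLinearGroup.scalar (Fin 2) z) φ -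
        ((HeckeCharacter.ofDirichlet χ₁ z : ℂˣ) : ℂ) • φ ∈ π.W' := by
  intro hcpt π τ N _ χ₁ h hdet z φ hφ
  -- the central character `ω` of `π(τ)`: `ω(ϖ_v) = det τ(Φ)` at the unramified places
  obtain ⟨ω, -, hω, hωfrob⟩ := h.exists_centralCharacter_eq_det
  -- `ω = ψ_{χ₁}`: equal values at almost every uniformizer
  have heq : ω = HeckeCharacter.ofDirichlet χ₁ := by
    refine HeckeCharacter.ext_of_eventually_valueAtUniformizer_eq ?_
    filter_upwards [h.eventually_isUnramifiedAt_galois, eventually_not_natGenerator_dvd N]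
      with v hv hvN
    obtain ⟨𝔓, h𝔓⟩ := v.primesAbove_nonempty
    obtain ⟨Φ, hΦ⟩ := HeightOneSpectrum.exists_isArithFrobAt_of_mem_primesAbove_holds h𝔓
    rw [(hωfrob v hv).2 𝔓 h𝔓 Φ hΦ, hdet v hv hvN 𝔓 h𝔓 Φ hΦ,
      HeckeCharacter.valueAtUniformizer_ofDirichlet χ₁ hvN]
  subst heq
  exact hω z φ hφ

end Summit.Langlands.Langlands.Theorems.CorrespondentFingerprint

end
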